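import Summits.QuantumFields.BalabanUV.Beta.D1BFx.LamDiffPartnerLetters
import Summits.QuantumFields.BalabanUV.Beta.D1BFx.LamRowGlue
import Summits.QuantumFields.BalabanUV.Beta.D1BFx.FineStencilBFBalaban
import Summits.QuantumFields.BalabanUV.Beta.D1BFx.SecondStencilBF

/-!
# `BalabanUV.Beta.D1BFx.RoadRestLamDiffRow` — road «BF-x» for binder row D1, slot (K), (S-N) dictionary, (L3) «ΔΛ-ROWS» FILE 4 «ΔΛ-ROW»:
# **THE (1.22) ROW OF THE Λ-DIFFERENCE REST MEMBER IS ZERO, MODULO THE LETTERS** — `B12Beta.secondMoment (restΔ n a S (c₁ • SdL n Hd) Wf (c₂ • WΔ)) μ ν = 0`: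
# FILE 1 `hF_restΔ_of_divFree` ∘ FILE 2 `lamDiff_row_eq_lamWords` ∘ `LamRowGlue.gLam_row_eq_zero_of_dict` ∘ FILE 3's partner letters; the `hRu` literal
# of the pointwise dictionary `hptw` for the member `Rk uΔ := ωgl · restΔ` with `Ru := 0`, `CU′ := 0`; and the instance at the road's `(SbfBal, Wbf)`

HONEST DEPENDENCY (page 1, mandatory): continuum YM on T⁴ ⇐ BetaPertH ∧ nine spine estimates (0/9 proved); BetaPertH ⇐ (D1) ∧ (D4) ∧
CAP+tail; G-an2-4 gates asym, D1 and NE2/3/4.  HONEST FRAMING (cell contract, verbatim): «discharging `BetaPertH` makes Bałaban's UV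
stability UNCONDITIONAL — a real constructive-QFT result; it is NOT the continuum limit and NOT the Clay problem.»  THIS MODULE DISCHARGES
NOTHING of the wall: it is [folklore] composition BY NAME.  What it does: the (1.22)-moment row (`hRu`) of the ONE rest member that carries a
Λ-TYPE literal-minus-road discrepancy of the first-jet pack and of the Λ₂-slot table is reduced to IDENTITIES plus the covariance letters of the typed
objects — the row's constant is `0` (the owner's expectation «`Ru := 0`, `CU := 0`», INBOX l.20896, CONFIRMED).  DISPLAYED hypotheses, none proved here:
the leg binder `Spr (Ga n a)`; the localisation ∕ block-covariance ∕ bond-swap sockets of `S`, `Wf`, `WΔ`; the tables' (LH) `hH` ∕ (CH) `hHcov`; the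
Λ₂-slot structure of `WΔ` (`hdecΔ`, `hTloc`, `hTcov`, `hWAa`, `hWAl`); the ONE REDUCE datum `hdivΔ` (first-bond divergence-freeness of the DIFFERENCE
fine kernel — weaker than, and supplied by, the datum for each system: FILE 1 §3); the zero-momentum data `c₁ ≠ 0`, `ε = ±1`, `hX`, the road's OWN
covariance letter (W1) for `ε • S` against `Ga`, and the Δ-letter (W2′)^Δ for the companion `Td` against the table `ffOf (Hd m 0)`.  No definition, no
`def … : Prop`, nothing cited, 0 sorry.  0∕4 row-D1 binders; (K) NOT closed; NOT (S-LIT) (the instance `Hd := H_lit − hessFF n` and the literal's pins are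
Q-JC-1′'s); NOT D1, NOT `BetaPertH`, NOT continuum, NOT Clay.

ABSOLUTE RULE (cell charter, verbatim): «No internally-minted statement may enter as a cited fact. Every hypothesis is either kernel-proved in
this package or a verbatim quotation of a PUBLISHED theorem with page reference. The manuscript(s) under audit are NOT citable for their own
disputed steps — they are the thing under adjudication; programme-internal (2001/route/tribunal) claims are never citable.»

CONTENT ([folklore]; `G := Ga n a`, `T := c₁ • SdL n Hd`, `Wf′ := c₂ • WΔ`).
* §1 **`secondMoment_restΔ_eq_zero_of_letters`** (generic road stencil `S` and road table `Wf`, each socket at its own rate);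
  **`abs_secondMoment_mul_restΔ_le_zero`** — THE `hRu` LITERAL the END's pointwise dictionary consumes for the member `Rk uΔ n μ ν z := ω · restΔ … μ ν z`:
  `|B12Beta.secondMoment (Rk uΔ n) μ ν − 0| ≤ 0`; `abs_secondMoment_restΔ_sub_zero_le_zero` (the same without a loop weight).
* §2 **`secondMoment_restΔ_SbfBal_eq_zero_of_letters`** — the INSTANCE at the road's pack ∕ table of record `S := SbfBal n a cE cVH cΛ cR cK cQ`,
  `Wf := Wbf cE₂ cJ4 cΛ₂ cR₂ cQ₂ WE WJ WΛ WR WQ` (sockets by `exists_biLoc_SbfBal` ∕ `SbfBal_translate_block` ∕ `biLoc_Wbf` ∕ `Wbf_translate_block` ∕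
  `Wbf_symm`; (W1) = the END's own `hW1` of `RoadEndLamRow.gLam_row_eq_zero_of_letters` VERBATIM).
Unit `b2b-balaban-gan24-formalise-leaf-05` (gen 49), G-an2-4 swarm leaf prover on road «BF-x» (L3); no existing file touched.
-/

noncomputable section

namespace Summit.QuantumFields.BalabanUV.Beta.D1BFx.RoadRestLamDiffRow

open Finset Filter Topology
open scoped BigOperators
open Literature.MathematicalPhysics.QuantumFieldTheory
open Literature.MathematicalPhysics.QuantumFieldTheory.Balaban1983to89
open Literature.MathematicalPhysics.QuantumFieldTheory.Balaban1983to89.Beta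
open B12Sec2to5 (l1)
open ExpKernelCalculus (Site MKer BiLoc comp shiftK)
open OneStepResolventKernel (Fib KInv wsum)
open InterLevelTransport (onLat)
open BalabanStepJets (lamCoeffOf)
open KernelWard (divV)
open StepJetData (biLoc_smul)
open Summit.QuantumFields.BalabanUV.Beta.TameKernelCalculus (Spr Loc trK biLoc_of_le)
open Summit.QuantumFields.BalabanUV.Beta.D1BFx.FineStencilBF (ffOf)
open Summit.QuantumFields.BalabanUV.Beta.D1BFx.GluonLeg (Ga)
open Summit.QuantumFields.BalabanUV.Beta.D1BFx.ReducedKernel (StencilR TableR)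
open Summit.QuantumFields.BalabanUV.Beta.D1BFx.DressedTadpoleTable (Table₂R)
open Summit.QuantumFields.BalabanUV.Beta.D1BFx.FineStencilBFBalaban (SbfBal exists_biLoc_SbfBal SbfBal_translate_block)
open Summit.QuantumFields.BalabanUV.Beta.D1BFx.SecondStencilBF (Wbf biLoc_Wbf Wbf_symm Wbf_translate_block)
open Summit.QuantumFields.BalabanUV.Beta.D1BFx.ReducedKernelPackDiff (fineHessΔ restΔ hF_restΔ_of_divFree)
open Summit.QuantumFields.BalabanUV.Beta.D1BFx.LamDiffDictionary (SdL Ndν Ndμ exists_biLoc_SdL lamDiff_row_eq_lamWords)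
open Summit.QuantumFields.BalabanUV.Beta.D1BFx.LamDiffPartnerLetters (SdL_translate Ndμ_cov Ndν_cov Ndν_decay Ndμ_decay tsum_Ndν_eq_zero tsum_Ndμ_eq_zero)
open Summit.QuantumFields.BalabanUV.Beta.D1BFx.LamRowGlue (gLam_row_eq_zero_of_dict)

/-! ## §1 The row is zero, modulo the letters -/

section Generic

variable (n : ℕ) [NeZero n] (a : ℝ) {S : StencilR} {Cs δs : ℝ} {Wf WΔ : Table₂R} {C2 δw CΔ δΔ : ℝ}
  {Hd : Fin 4 → Site 4 → MKer 4 (Fib 3)} {CH δH : ℝ} {Td WAd : Fin 4 → Site 4 → Fin 4 → Site 4 → MKer 4 (Fin 4)} {CT δT : ℝ} {c₁ c₂ : ℝ}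

/-- [folklore] **THE (1.22) ROW OF THE Λ-DIFFERENCE REST MEMBER IS ZERO, MODULO THE LETTERS.**  At every blocking `n`: for `0 < a`, `Spr (Ga n a)`; a road
stencil `S` bond-localised and block covariant; a road table `Wf` bi-localised, jointly block covariant, bond-swap symmetric; a table family `Hd` with (LH) `hH`,
(CH) `hHcov`; a companion `Td` with `hTloc`∕`hTcov`; a table difference `WΔ` bi-localised, jointly block covariant, bond-swap symmetric, carrying the Λ₂-slot
structure `hdecΔ` with a localised transpose-antisymmetric `WAd`; the ONE REDUCE datum `hdivΔ`; and the zero-momentum data `c₁ ≠ 0`, `ε = ±1`, `hX`, (W1) for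
`ε • S`, (W2′)^Δ:  `B12Beta.secondMoment (restΔ n a S (c₁ • SdL n Hd) Wf (c₂ • WΔ)) μ ν = 0`. -/
theorem secondMoment_restΔ_eq_zero_of_letters (ha : 0 < a) (hGa : Spr (Ga n a))
    -- the road stencil
    (hδs : 0 < δs) (hS : ∀ κ u, BiLoc (S κ u) u u Cs δs)
    (hScov : ∀ (κ : Fin 4) (u t : Site 4), S κ (u + (n : ℤ) • t) = shiftK (-((n : ℤ) • t)) (S κ u))
    -- the road table
    (hδw : 0 < δw) (hW : ∀ κ u l u', BiLoc (Wf κ u l u') u u' C2 δw)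
    (hWcov : ∀ (κ : Fin 4) (u : Site 4) (l : Fin 4) (u' t : Site 4), Wf κ (u + (n : ℤ) • t) l (u' + (n : ℤ) • t) = shiftK (-((n : ℤ) • t)) (Wf κ u l u'))
    (hWs : ∀ (κ : Fin 4) (u : Site 4) (l : Fin 4) (u' : Site 4), Wf κ u l u' = Wf l u' κ u)
    -- the Λ-difference data: tables, companion, the Λ₂-slot table
    (hδH : 0 < δH) (hH : ∀ (m : Fin 4) (y : Site 4), BiLoc (ffOf (Hd m y)) ((n : ℤ) • y) ((n : ℤ) • y) CH δH)
    (hHcov : ∀ (m : Fin 4) (y t : Site 4), Hd m (y + t) = shiftK (-((n : ℤ) • t)) (Hd m y))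
    (hδT : 0 < δT) (hTloc : ∀ m y κ u, BiLoc (Td m y κ u) ((n : ℤ) • y) ((n : ℤ) • y) (CT * Real.exp (-δT * l1 ((n : ℤ) • y - u))) δT)
    (hTcov : ∀ m y κ u t, Td m (y + t) κ (u + (n : ℤ) • t) = shiftK (-((n : ℤ) • t)) (Td m y κ u))
    (hδΔ : 0 < δΔ) (hΔ : ∀ κ u l u', BiLoc (WΔ κ u l u') u u' CΔ δΔ)
    (hΔcov : ∀ (κ : Fin 4) (u : Site 4) (l : Fin 4) (u' t : Site 4), WΔ κ (u + (n : ℤ) • t) l (u' + (n : ℤ) • t) = shiftK (-((n : ℤ) • t)) (WΔ κ u l u'))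
    (hΔs : ∀ (κ : Fin 4) (u : Site 4) (l : Fin 4) (u' : Site 4), WΔ κ u l u' = WΔ l u' κ u)
    (hdecΔ : ∀ κ u l u', WΔ κ u l u' =
      (∑ m : Fin 4, wsum (onLat n (fun y => lamCoeffOf (KInv (N := n) (d := 3)) n m y l u')) (fun v => onLat n (fun y => Td m y κ u) v))
      + (∑ m : Fin 4, wsum (onLat n (fun y => lamCoeffOf (KInv (N := n) (d := 3)) n m y κ u)) (fun v => onLat n (fun y => Td m y l u') v))
      + WAd κ u l u')
    (hWAa : ∀ κ u l u', trK (WAd κ u l u') = -WAd κ u l u') (hWAl : ∀ κ u l u', Loc (WAd κ u l u'))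
    -- the ONE REDUCE datum: first-bond divergence-freeness of the difference kernel
    (hdivΔ : ∀ (l' : Fin 4) (u' u : Site 4), ∑ κ' : Fin 4,
      (fineHessΔ n a S (fun κ u => c₁ • SdL n Hd κ u) Wf (fun κ u l u' => c₂ • WΔ κ u l u') κ' l' (u - Pi.single κ' 1) u'
        - fineHessΔ n a S (fun κ u => c₁ • SdL n Hd κ u) Wf (fun κ u l u' => c₂ • WΔ κ u l u') κ' l' u u') = 0)
    -- the zero-momentum data: `c₁ ≠ 0`, `ε = ±1`, `hX`, (W1) for `ε • S`, (W2′)^Δ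
    (hc₁ : c₁ ≠ 0) {ε : ℝ} (hε : ε = 1 ∨ ε = -1) {X : Site 4 → MKer 4 (Fin 4)} {Cx δx : ℝ} (hδx : 0 < δx) (hX : ∀ u, BiLoc (X u) u u Cx δx)
    (hW1 : ∀ u, comp (comp (Ga n a) (divV (fun κ v => ε • S κ v) u)) (Ga n a) = comp (Ga n a) (X u) - comp (X u) (Ga n a))
    (hW2 : ∀ (m : Fin 4) (u : Site 4),
      divV (fun κ v => (-(ε * (c₂ / c₁))) • Td m 0 κ v) u = comp (X u) (ffOf (Hd m 0)) - comp (ffOf (Hd m 0)) (X u))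
    (μ ν : Fin 4) :
    B12Beta.secondMoment (restΔ n a S (fun κ u => c₁ • SdL n Hd κ u) Wf (fun κ u l u' => c₂ • WΔ κ u l u')) μ ν = 0 := by
  have hn : 1 ≤ n := NeZero.one_le
  -- ONE common rate for the four families of FILE 1
  obtain ⟨Cl, δl, hδl, hSl⟩ := exists_biLoc_SdL n hδH hH
  set δ₀ : ℝ := min (min δs δw) (min δΔ δl) with hδ₀def
  have hδ₀ : 0 < δ₀ := lt_min (lt_min hδs hδw) (lt_min hδΔ hδl)
  have hS₀ : ∀ (κ : Fin 4) (u : Site 4), BiLoc (S κ u) u u (|Cs|) δ₀ :=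
    fun κ u => biLoc_of_le (hS κ u) ((min_le_left _ _).trans (min_le_left _ _))
  have hT₀ : ∀ (κ : Fin 4) (u : Site 4), BiLoc ((fun κ u => c₁ • SdL n Hd κ u) κ u) u u (|c₁| * |Cl|) δ₀ :=
    fun κ u => biLoc_smul (biLoc_of_le (hSl κ u) ((min_le_right _ _).trans (min_le_right _ _))) c₁
  have hW₀ : ∀ (κ : Fin 4) (u : Site 4) (l : Fin 4) (u' : Site 4), BiLoc (Wf κ u l u') u u' (|C2|) δ₀ :=
    fun κ u l u' => biLoc_of_le (hW κ u l u') ((min_le_left _ _).trans (min_le_right _ _))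
  have hΔ₀ : ∀ (κ : Fin 4) (u : Site 4) (l : Fin 4) (u' : Site 4), BiLoc ((fun κ u l u' => c₂ • WΔ κ u l u') κ u l u') u u' (|c₂| * |CΔ|) δ₀ :=
    fun κ u l u' => biLoc_smul (biLoc_of_le (hΔ κ u l u') ((min_le_right _ _).trans (min_le_left _ _))) c₂
  -- block covariance and bond swap of `T` and `Wf′`
  have hTcov' : ∀ (κ : Fin 4) (u t : Site 4),
      (fun κ u => c₁ • SdL n Hd κ u) κ (u + (n : ℤ) • t) = shiftK (-((n : ℤ) • t)) ((fun κ u => c₁ • SdL n Hd κ u) κ u) := fun κ u t => by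
    simp only [SdL_translate n hHcov κ u t]
    rfl
  have hW'cov : ∀ (κ : Fin 4) (u : Site 4) (l : Fin 4) (u' t : Site 4), (fun κ u l u' => c₂ • WΔ κ u l u') κ (u + (n : ℤ) • t) l (u' + (n : ℤ) • t)
      = shiftK (-((n : ℤ) • t)) ((fun κ u l u' => c₂ • WΔ κ u l u') κ u l u') := fun κ u l u' t => by
    simp only [hΔcov κ u l u' t]
    rfl
  have hW's : ∀ (κ : Fin 4) (u : Site 4) (l : Fin 4) (u' : Site 4),
      (fun κ u l u' => c₂ • WΔ κ u l u') κ u l u' = (fun κ u l u' => c₂ • WΔ κ u l u') l u' κ u := fun κ u l u' => by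
    simp only [hΔs κ u l u']
  have hWl : ∀ κ u l u', Loc (Wf κ u l u') := fun κ u l u' => ⟨u, u', C2, δw, hδw, hW κ u l u'⟩
  -- FILE 3's partner letters
  obtain ⟨Cν, δν, hδν, hNdν⟩ := Ndν_decay n (c₁ := c₁) (c₂ := c₂) hGa hδs hS hδH hH hδT hTloc μ
  obtain ⟨Cμ, δμ, hδμ, hNdμ⟩ := Ndμ_decay n (c₁ := c₁) (c₂ := c₂) hGa hδs hS hδH hH hδT hTloc ν
  have hcovν := Ndν_cov n (a := a) (c₁ := c₁) (c₂ := c₂) hScov hHcov hTcov μ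
  have hcovμ := Ndμ_cov n (a := a) (c₁ := c₁) (c₂ := c₂) hScov hHcov hTcov ν
  -- REDUCE (FILE 1), DICTIONARY (FILE 2), GLUE (`LamRowGlue`), ZERO MOMENTUM (FILE 3)
  refine gLam_row_eq_zero_of_dict (N := n) (d := 3) μ ν _ (Ndν n a S Hd Td c₁ c₂ μ) (Ndμ n a S Hd Td c₁ c₂ ν) hδν hδμ ?_
    hcovν hNdν (fun m => tsum_Ndν_eq_zero n hGa hδs hS hδH hH hδT hTloc hc₁ hε hδx hX hW1 m (hW2 m) μ)
    hcovμ hNdμ (fun m => tsum_Ndμ_eq_zero n hGa hδs hS hδH hH hδT hTloc hc₁ hε hδx hX hW1 m (hW2 m) ν)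
  rw [hF_restΔ_of_divFree n a hn hGa hS₀ hT₀ hW₀ hΔ₀ hδ₀ hScov hTcov' hWcov hW'cov hWs hW's hdivΔ μ ν]
  exact lamDiff_row_eq_lamWords n a μ ν ha hGa hδs hS hδH hH hWl hδΔ hΔ hδT hdecΔ hTloc hWAa hWAl c₁ c₂ hδν hδμ hNdν hNdμ hcovμ

/-- [folklore] Homogeneity of the (1.22) moment: `secondMoment (ω · P) μ ν = ω · secondMoment P μ ν` (no summability needed). -/
theorem secondMoment_const_mul (ω : ℝ) (P : B12Beta.Kernel 4) (μ ν : Fin 4) :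
    B12Beta.secondMoment (fun μ ν z => ω * P μ ν z) μ ν = ω * B12Beta.secondMoment P μ ν := by
  simp only [B12Beta.secondMoment, ← tsum_mul_left]
  exact tsum_congr fun z => by ring

/-- [folklore] **THE `hRu` LITERAL OF THE POINTWISE DICTIONARY FOR THE MEMBER `Rk uΔ n μ ν z := ω · restΔ … μ ν z`** (any loop weight `ω`, e.g. `ωgl n`):
`|B12Beta.secondMoment (Rk uΔ n) μ ν − 0| ≤ 0` — the row of `RoadEndBFxDictPointwiseS.hdict_of_pointwise` with `Ru uΔ := 0`, `CU′ uΔ := 0`, under exactly the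
letters of `secondMoment_restΔ_eq_zero_of_letters`. -/
theorem abs_secondMoment_mul_restΔ_le_zero (ha : 0 < a) (hGa : Spr (Ga n a))
    (hδs : 0 < δs) (hS : ∀ κ u, BiLoc (S κ u) u u Cs δs)
    (hScov : ∀ (κ : Fin 4) (u t : Site 4), S κ (u + (n : ℤ) • t) = shiftK (-((n : ℤ) • t)) (S κ u))
    (hδw : 0 < δw) (hW : ∀ κ u l u', BiLoc (Wf κ u l u') u u' C2 δw)
    (hWcov : ∀ (κ : Fin 4) (u : Site 4) (l : Fin 4) (u' t : Site 4), Wf κ (u + (n : ℤ) • t) l (u' + (n : ℤ) • t) = shiftK (-((n : ℤ) • t)) (Wf κ u l u'))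
    (hWs : ∀ (κ : Fin 4) (u : Site 4) (l : Fin 4) (u' : Site 4), Wf κ u l u' = Wf l u' κ u)
    (hδH : 0 < δH) (hH : ∀ (m : Fin 4) (y : Site 4), BiLoc (ffOf (Hd m y)) ((n : ℤ) • y) ((n : ℤ) • y) CH δH)
    (hHcov : ∀ (m : Fin 4) (y t : Site 4), Hd m (y + t) = shiftK (-((n : ℤ) • t)) (Hd m y))
    (hδT : 0 < δT) (hTloc : ∀ m y κ u, BiLoc (Td m y κ u) ((n : ℤ) • y) ((n : ℤ) • y) (CT * Real.exp (-δT * l1 ((n : ℤ) • y - u))) δT)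
    (hTcov : ∀ m y κ u t, Td m (y + t) κ (u + (n : ℤ) • t) = shiftK (-((n : ℤ) • t)) (Td m y κ u))
    (hδΔ : 0 < δΔ) (hΔ : ∀ κ u l u', BiLoc (WΔ κ u l u') u u' CΔ δΔ)
    (hΔcov : ∀ (κ : Fin 4) (u : Site 4) (l : Fin 4) (u' t : Site 4), WΔ κ (u + (n : ℤ) • t) l (u' + (n : ℤ) • t) = shiftK (-((n : ℤ) • t)) (WΔ κ u l u'))
    (hΔs : ∀ (κ : Fin 4) (u : Site 4) (l : Fin 4) (u' : Site 4), WΔ κ u l u' = WΔ l u' κ u)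
    (hdecΔ : ∀ κ u l u', WΔ κ u l u' =
      (∑ m : Fin 4, wsum (onLat n (fun y => lamCoeffOf (KInv (N := n) (d := 3)) n m y l u')) (fun v => onLat n (fun y => Td m y κ u) v))
      + (∑ m : Fin 4, wsum (onLat n (fun y => lamCoeffOf (KInv (N := n) (d := 3)) n m y κ u)) (fun v => onLat n (fun y => Td m y l u') v))
      + WAd κ u l u')
    (hWAa : ∀ κ u l u', trK (WAd κ u l u') = -WAd κ u l u') (hWAl : ∀ κ u l u', Loc (WAd κ u l u'))
    (hdivΔ : ∀ (l' : Fin 4) (u' u : Site 4), ∑ κ' : Fin 4,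
      (fineHessΔ n a S (fun κ u => c₁ • SdL n Hd κ u) Wf (fun κ u l u' => c₂ • WΔ κ u l u') κ' l' (u - Pi.single κ' 1) u'
        - fineHessΔ n a S (fun κ u => c₁ • SdL n Hd κ u) Wf (fun κ u l u' => c₂ • WΔ κ u l u') κ' l' u u') = 0)
    (hc₁ : c₁ ≠ 0) {ε : ℝ} (hε : ε = 1 ∨ ε = -1) {X : Site 4 → MKer 4 (Fin 4)} {Cx δx : ℝ} (hδx : 0 < δx) (hX : ∀ u, BiLoc (X u) u u Cx δx)
    (hW1 : ∀ u, comp (comp (Ga n a) (divV (fun κ v => ε • S κ v) u)) (Ga n a) = comp (Ga n a) (X u) - comp (X u) (Ga n a))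
    (hW2 : ∀ (m : Fin 4) (u : Site 4),
      divV (fun κ v => (-(ε * (c₂ / c₁))) • Td m 0 κ v) u = comp (X u) (ffOf (Hd m 0)) - comp (ffOf (Hd m 0)) (X u))
    (ω : ℝ) (μ ν : Fin 4) :
    |B12Beta.secondMoment (fun μ ν z => ω * restΔ n a S (fun κ u => c₁ • SdL n Hd κ u) Wf (fun κ u l u' => c₂ • WΔ κ u l u') μ ν z) μ ν - 0| ≤ 0 := by
  rw [secondMoment_const_mul, secondMoment_restΔ_eq_zero_of_letters n a ha hGa hδs hS hScov hδw hW hWcov hWs hδH hH hHcov hδT hTloc hTcov hδΔ hΔ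
    hΔcov hΔs hdecΔ hWAa hWAl hdivΔ hc₁ hε hδx hX hW1 hW2 μ ν, mul_zero, sub_zero, abs_zero]

/-- [folklore] The same `hRu` literal WITHOUT a loop weight (the member `Rk uΔ := restΔ …` itself): `|B12Beta.secondMoment (restΔ …) μ ν − 0| ≤ 0`. -/
theorem abs_secondMoment_restΔ_sub_zero_le_zero (ha : 0 < a) (hGa : Spr (Ga n a))
    (hδs : 0 < δs) (hS : ∀ κ u, BiLoc (S κ u) u u Cs δs)
    (hScov : ∀ (κ : Fin 4) (u t : Site 4), S κ (u + (n : ℤ) • t) = shiftK (-((n : ℤ) • t)) (S κ u))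
    (hδw : 0 < δw) (hW : ∀ κ u l u', BiLoc (Wf κ u l u') u u' C2 δw)
    (hWcov : ∀ (κ : Fin 4) (u : Site 4) (l : Fin 4) (u' t : Site 4), Wf κ (u + (n : ℤ) • t) l (u' + (n : ℤ) • t) = shiftK (-((n : ℤ) • t)) (Wf κ u l u'))
    (hWs : ∀ (κ : Fin 4) (u : Site 4) (l : Fin 4) (u' : Site 4), Wf κ u l u' = Wf l u' κ u)
    (hδH : 0 < δH) (hH : ∀ (m : Fin 4) (y : Site 4), BiLoc (ffOf (Hd m y)) ((n : ℤ) • y) ((n : ℤ) • y) CH δH)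
    (hHcov : ∀ (m : Fin 4) (y t : Site 4), Hd m (y + t) = shiftK (-((n : ℤ) • t)) (Hd m y))
    (hδT : 0 < δT) (hTloc : ∀ m y κ u, BiLoc (Td m y κ u) ((n : ℤ) • y) ((n : ℤ) • y) (CT * Real.exp (-δT * l1 ((n : ℤ) • y - u))) δT)
    (hTcov : ∀ m y κ u t, Td m (y + t) κ (u + (n : ℤ) • t) = shiftK (-((n : ℤ) • t)) (Td m y κ u))
    (hδΔ : 0 < δΔ) (hΔ : ∀ κ u l u', BiLoc (WΔ κ u l u') u u' CΔ δΔ)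
    (hΔcov : ∀ (κ : Fin 4) (u : Site 4) (l : Fin 4) (u' t : Site 4), WΔ κ (u + (n : ℤ) • t) l (u' + (n : ℤ) • t) = shiftK (-((n : ℤ) • t)) (WΔ κ u l u'))
    (hΔs : ∀ (κ : Fin 4) (u : Site 4) (l : Fin 4) (u' : Site 4), WΔ κ u l u' = WΔ l u' κ u)
    (hdecΔ : ∀ κ u l u', WΔ κ u l u' =
      (∑ m : Fin 4, wsum (onLat n (fun y => lamCoeffOf (KInv (N := n) (d := 3)) n m y l u')) (fun v => onLat n (fun y => Td m y κ u) v))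
      + (∑ m : Fin 4, wsum (onLat n (fun y => lamCoeffOf (KInv (N := n) (d := 3)) n m y κ u)) (fun v => onLat n (fun y => Td m y l u') v))
      + WAd κ u l u')
    (hWAa : ∀ κ u l u', trK (WAd κ u l u') = -WAd κ u l u') (hWAl : ∀ κ u l u', Loc (WAd κ u l u'))
    (hdivΔ : ∀ (l' : Fin 4) (u' u : Site 4), ∑ κ' : Fin 4,
      (fineHessΔ n a S (fun κ u => c₁ • SdL n Hd κ u) Wf (fun κ u l u' => c₂ • WΔ κ u l u') κ' l' (u - Pi.single κ' 1) u'
        - fineHessΔ n a S (fun κ u => c₁ • SdL n Hd κ u) Wf (fun κ u l u' => c₂ • WΔ κ u l u') κ' l' u u') = 0)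
    (hc₁ : c₁ ≠ 0) {ε : ℝ} (hε : ε = 1 ∨ ε = -1) {X : Site 4 → MKer 4 (Fin 4)} {Cx δx : ℝ} (hδx : 0 < δx) (hX : ∀ u, BiLoc (X u) u u Cx δx)
    (hW1 : ∀ u, comp (comp (Ga n a) (divV (fun κ v => ε • S κ v) u)) (Ga n a) = comp (Ga n a) (X u) - comp (X u) (Ga n a))
    (hW2 : ∀ (m : Fin 4) (u : Site 4),
      divV (fun κ v => (-(ε * (c₂ / c₁))) • Td m 0 κ v) u = comp (X u) (ffOf (Hd m 0)) - comp (ffOf (Hd m 0)) (X u))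
    (μ ν : Fin 4) :
    |B12Beta.secondMoment (restΔ n a S (fun κ u => c₁ • SdL n Hd κ u) Wf (fun κ u l u' => c₂ • WΔ κ u l u')) μ ν - 0| ≤ 0 := by
  rw [secondMoment_restΔ_eq_zero_of_letters n a ha hGa hδs hS hScov hδw hW hWcov hWs hδH hH hHcov hδT hTloc hTcov hδΔ hΔ hΔcov hΔs hdecΔ hWAa hWAl
    hdivΔ hc₁ hε hδx hX hW1 hW2 μ ν, sub_zero, abs_zero]

end Generic

/-! ## §2 The instance at the road's pack and table of record -/

section Bal

variable (n : ℕ) [NeZero n] (a cE cVH cΛ cR cK cQ cE₂ cJ4 cΛ₂ cR₂ cQ₂ : ℝ) {WE WJ WΛ WR WQ WΔ : TableR} {CE CJ CΛt CR CQ CΔ δW : ℝ}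
  {Hd : Fin 4 → Site 4 → MKer 4 (Fib 3)} {CH δH : ℝ} {Td WAd : Fin 4 → Site 4 → Fin 4 → Site 4 → MKer 4 (Fin 4)} {CT δT : ℝ} {c₁ c₂ : ℝ}

/-- [folklore] **THE INSTANCE AT THE ROAD'S PACK ∕ TABLE OF RECORD**: `S := SbfBal n a cE cVH cΛ cR cK cQ`, `Wf := Wbf cE₂ cJ4 cΛ₂ cR₂ cQ₂ WE WJ WΛ WR WQ` — the
five slot tables bi-localised at one rate `δW > 0`, block covariant, bond-swap symmetric (the END's `hE…hQ`, `hEc…hQc`, `hEs…hQs` VERBATIM), the Λ-difference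
data as in §1 (with `WΔ` at the same rate `δW`), and (W1) = `RoadEndLamRow.gLam_row_eq_zero_of_letters`' `hW1` VERBATIM:
`B12Beta.secondMoment (restΔ n a SbfBal (c₁ • SdL n Hd) Wbf (c₂ • WΔ)) μ ν = 0`. -/
theorem secondMoment_restΔ_SbfBal_eq_zero_of_letters (ha : 0 < a) (hGa : Spr (Ga n a)) (hδW : 0 < δW)
    (hE : ∀ κ u l u', BiLoc (WE κ u l u') u u' CE δW) (hJ : ∀ κ u l u', BiLoc (WJ κ u l u') u u' CJ δW)
    (hΛ : ∀ κ u l u', BiLoc (WΛ κ u l u') u u' CΛt δW) (hR : ∀ κ u l u', BiLoc (WR κ u l u') u u' CR δW)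
    (hQ : ∀ κ u l u', BiLoc (WQ κ u l u') u u' CQ δW)
    (hEc : ∀ (κ : Fin 4) (u : Site 4) (l : Fin 4) (u' t : Site 4), WE κ (u + (n : ℤ) • t) l (u' + (n : ℤ) • t) = shiftK (-((n : ℤ) • t)) (WE κ u l u'))
    (hJc : ∀ (κ : Fin 4) (u : Site 4) (l : Fin 4) (u' t : Site 4), WJ κ (u + (n : ℤ) • t) l (u' + (n : ℤ) • t) = shiftK (-((n : ℤ) • t)) (WJ κ u l u'))
    (hΛc : ∀ (κ : Fin 4) (u : Site 4) (l : Fin 4) (u' t : Site 4), WΛ κ (u + (n : ℤ) • t) l (u' + (n : ℤ) • t) = shiftK (-((n : ℤ) • t)) (WΛ κ u l u'))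
    (hRc : ∀ (κ : Fin 4) (u : Site 4) (l : Fin 4) (u' t : Site 4), WR κ (u + (n : ℤ) • t) l (u' + (n : ℤ) • t) = shiftK (-((n : ℤ) • t)) (WR κ u l u'))
    (hQc : ∀ (κ : Fin 4) (u : Site 4) (l : Fin 4) (u' t : Site 4), WQ κ (u + (n : ℤ) • t) l (u' + (n : ℤ) • t) = shiftK (-((n : ℤ) • t)) (WQ κ u l u'))
    (hEs : ∀ κ u l u', WE κ u l u' = WE l u' κ u) (hJs : ∀ κ u l u', WJ κ u l u' = WJ l u' κ u)
    (hΛs : ∀ κ u l u', WΛ κ u l u' = WΛ l u' κ u) (hRs : ∀ κ u l u', WR κ u l u' = WR l u' κ u) (hQs : ∀ κ u l u', WQ κ u l u' = WQ l u' κ u)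
    -- the Λ-difference data
    (hδH : 0 < δH) (hH : ∀ (m : Fin 4) (y : Site 4), BiLoc (ffOf (Hd m y)) ((n : ℤ) • y) ((n : ℤ) • y) CH δH)
    (hHcov : ∀ (m : Fin 4) (y t : Site 4), Hd m (y + t) = shiftK (-((n : ℤ) • t)) (Hd m y))
    (hδT : 0 < δT) (hTloc : ∀ m y κ u, BiLoc (Td m y κ u) ((n : ℤ) • y) ((n : ℤ) • y) (CT * Real.exp (-δT * l1 ((n : ℤ) • y - u))) δT)
    (hTcov : ∀ m y κ u t, Td m (y + t) κ (u + (n : ℤ) • t) = shiftK (-((n : ℤ) • t)) (Td m y κ u))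
    (hΔ : ∀ κ u l u', BiLoc (WΔ κ u l u') u u' CΔ δW)
    (hΔc : ∀ (κ : Fin 4) (u : Site 4) (l : Fin 4) (u' t : Site 4), WΔ κ (u + (n : ℤ) • t) l (u' + (n : ℤ) • t) = shiftK (-((n : ℤ) • t)) (WΔ κ u l u'))
    (hΔs : ∀ κ u l u', WΔ κ u l u' = WΔ l u' κ u)
    (hdecΔ : ∀ κ u l u', WΔ κ u l u' =
      (∑ m : Fin 4, wsum (onLat n (fun y => lamCoeffOf (KInv (N := n) (d := 3)) n m y l u')) (fun v => onLat n (fun y => Td m y κ u) v))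
      + (∑ m : Fin 4, wsum (onLat n (fun y => lamCoeffOf (KInv (N := n) (d := 3)) n m y κ u)) (fun v => onLat n (fun y => Td m y l u') v))
      + WAd κ u l u')
    (hWAa : ∀ κ u l u', trK (WAd κ u l u') = -WAd κ u l u') (hWAl : ∀ κ u l u', Loc (WAd κ u l u'))
    -- the ONE REDUCE datum
    (hdivΔ : ∀ (l' : Fin 4) (u' u : Site 4), ∑ κ' : Fin 4,
      (fineHessΔ n a (SbfBal n a cE cVH cΛ cR cK cQ) (fun κ u => c₁ • SdL n Hd κ u) (Wbf cE₂ cJ4 cΛ₂ cR₂ cQ₂ WE WJ WΛ WR WQ)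
          (fun κ u l u' => c₂ • WΔ κ u l u') κ' l' (u - Pi.single κ' 1) u'
        - fineHessΔ n a (SbfBal n a cE cVH cΛ cR cK cQ) (fun κ u => c₁ • SdL n Hd κ u) (Wbf cE₂ cJ4 cΛ₂ cR₂ cQ₂ WE WJ WΛ WR WQ)
          (fun κ u l u' => c₂ • WΔ κ u l u') κ' l' u u') = 0)
    -- the zero-momentum data
    (hc₁ : c₁ ≠ 0) {ε : ℝ} (hε : ε = 1 ∨ ε = -1) {X : Site 4 → MKer 4 (Fin 4)} {Cx δx : ℝ} (hδx : 0 < δx) (hX : ∀ u, BiLoc (X u) u u Cx δx)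
    (hW1 : ∀ u, comp (comp (Ga n a) (divV (fun κ v => ε • SbfBal n a cE cVH cΛ cR cK cQ κ v) u)) (Ga n a) =
      comp (Ga n a) (X u) - comp (X u) (Ga n a))
    (hW2 : ∀ (m : Fin 4) (u : Site 4),
      divV (fun κ v => (-(ε * (c₂ / c₁))) • Td m 0 κ v) u = comp (X u) (ffOf (Hd m 0)) - comp (ffOf (Hd m 0)) (X u))
    (μ ν : Fin 4) :
    B12Beta.secondMoment (restΔ n a (SbfBal n a cE cVH cΛ cR cK cQ) (fun κ u => c₁ • SdL n Hd κ u)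
      (Wbf cE₂ cJ4 cΛ₂ cR₂ cQ₂ WE WJ WΛ WR WQ) (fun κ u l u' => c₂ • WΔ κ u l u')) μ ν = 0 := by
  obtain ⟨Cs, δS, hδS, hS⟩ := exists_biLoc_SbfBal n a ha cE cVH cΛ cR cK cQ
  exact secondMoment_restΔ_eq_zero_of_letters n a ha hGa hδS hS (SbfBal_translate_block n a ha cE cVH cΛ cR cK cQ) hδW
    (biLoc_Wbf (cE₂ := cE₂) (cJ4 := cJ4) (cΛ₂ := cΛ₂) (cR₂ := cR₂) (cQ₂ := cQ₂) hE hJ hΛ hR hQ)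
    (Wbf_translate_block hEc hJc hΛc hRc hQc) (Wbf_symm hEs hJs hΛs hRs hQs) hδH hH hHcov hδT hTloc hTcov hδW hΔ hΔc hΔs hdecΔ hWAa hWAl
    hdivΔ hc₁ hε hδx hX hW1 hW2 μ ν

end Bal

end Summit.QuantumFields.BalabanUV.Beta.D1BFx.RoadRestLamDiffRow

end
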